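import Literature.Analysis.Matrix.CoerciveCombesThomas
import Literature.Analysis.Matrix.LocalisedResponse
import Mathlib.Analysis.Calculus.ImplicitFunction.Bivariate
import Mathlib.Algebra.Order.Chebyshev
import HarnessLib

/-!
# Localised response, II: the real Combes–Thomas bound, the end-to-end response row, and `Δ² log det` with exponentially
# localised variations

Topic `Literature/Analysis/Matrix`; namespace `Literature.Analysis.Matrix`.  Sequel of `CoerciveCombesThomas.lean` (complex matrices),
`LocalisedResponse.lean` (propagation of exponential localisation, the response row, `abs_trace_mul4_le_of_expLocalised`) and
`LogDetMixedDifference.lean` (block-supported variations, `abs_fourPt_log_det_le`).  Everything here is PROVED; no definitions, no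
named facts.

* §1 ★`coercive_combes_thomas_real` — the coercive Combes–Thomas bound for REAL matrices (`|A⁻¹ i j| ≤ (2∕g)·e^{−θ·dist i j}` from the
  floor `g²Σv² ≤ Σ(Av)²`, range one, row∕column sums `≤ h`, `h(e^θ − 1) ≤ g∕2`), by complexification of the tree's complex theorem;
  `sq_floor_of_quadratic_floor` — the quadratic-form floor `mΣv² ≤ Σ v·(Av)` (positive-definite Hessian) gives that floor with `g = m`;
  ★★`abs_response_le_of_floor_far` — the END-TO-END localisation of the first-order response: floor + range + sums + the response
  row `w + A·m′ = 0` with `w` supported in `I`, `|w| ≤ δ` ⟹ `|m′ k| ≤ (2∕g)·δ·|I|·e^{−θR}` at every `k` that is `R`-far from `I`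
  ([Balaban1985Variational] Thm 1, (10) p. 279: the linear-algebra content, with NO decay hypothesis left displayed).
* §2 ★★`abs_fourPt_log_det_le_of_expLocalised` — `LogDetMixedDifference.abs_fourPt_log_det_le` with the BLOCK rows `hD0 hDb hE0 hEb hA hB`
  replaced by PROFILE rows: `|M′(s,1) x a| ≤ δ·e^{−θ·d a}`, `|(M(s,1) − M(s,0)) b c| ≤ ε·e^{−θ·d′ b}`, `R ≤ d a + dist a b + d′ b`,
  `|M(s,1)⁻¹ a b| ≤ α·e^{−θ·dist a b}`, `|M(s,0)⁻¹| ≤ β₀`, mixed response `≤ η` ⟹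
  `|Δ² log det| ≤ |n|⁴·α·ε·β₀·δ·e^{−θR} + |n|²·β₀·η`.
* §3 ★`exists_branch_response_row` — the responding branch EXISTS and satisfies the response row (Mathlib's bivariate implicit
  function theorem `hasStrictFDerivAt_implicitFunctionOfBivariate`, derivative `−(∂₂G)⁻¹ ∘ ∂₁G`, read in matrix form);
  ★★`exists_branch_localisedResponse` — [Balaban1985Variational] (10)'s finite-dimensional mechanism END TO END: gradient field with
  invertible, gapped, finite-range Hessian and an `s`-partial supported in `I` ⟹ a differentiable branch of critical points whose
  response is `≤ (2∕g)·δ·|I|·e^{−θR}` at every index `R`-far from `I`.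

WHY.  In the one-loop application the matrix family is the Hessian `M(s,t) = Hess A(U₀(x(s,t)))` at a background field `U₀` that
RESPONDS to the move of the bond variables everywhere with exponential tails ([Balaban1985Variational] (10)), so the variations
`∂ₛM`, `ΔₜM` are exponentially localised near the two bonds, not supported there: the block rows of `abs_fourPt_log_det_le` are met only
by a frozen background; the profile rows here are the inhabitable ones.  The mixed-response sup `η` is itself `O(μ + e^{−θR})` by
`LocalisedResponse.abs_mixedResponse_le` once the model supplies the second-order row.  HONEST SCOPE: finite-dimensional linear algebra +
one FTC; nothing here bears on the Yang–Mills mass gap (Clay), which is NOT proved.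

References: J.-M. Combes, L. Thomas, CMP 34 (1973) 251 [CombesThomas1973]; M. Aizenman, S. Warzel, *Random Operators* (2015) §10.3
[AizenmanWarzel2015]; T. Bałaban, CMP 102 (1985) 277, Thm 1, (10) p. 279 [Balaban1985Variational]; J. Glimm, A. Jaffe, *Quantum Physics*
(1987) §18.2 [GlimmJaffe1987]; R. A. Horn, C. R. Johnson, *Matrix Analysis* (2013) §0.8.10 [HornJohnson2013].
-/

noncomputable section

open Matrix Finset Filter
open scoped Matrix Topology

namespace Literature.Analysis.Matrix

variable {ι : Type*} [Fintype ι] [DecidableEq ι]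
variable {n : Type*} [Fintype n] [DecidableEq n]

/-! ## §1 The real Combes–Thomas bound and the end-to-end response row -/

/-- ★ **The coercive Combes–Thomas bound, REAL EDITION.**  `Literature.Analysis.Matrix.coercive_combes_thomas` is stated for
complex matrices; Hessians are real.  For `A : Matrix ι ι ℝ` of range one w.r.t. an `ℕ`-pseudo-metric `dist`, absolute row∕column
sums `≤ h` off `{dist = 0}`, coercivity floor `g²·Σ (v i)² ≤ Σ ((A v) i)²` (`g > 0`) and `h·(e^θ − 1) ≤ g∕2` (`θ ≥ 0`):
`det A ≠ 0` and `|A⁻¹ i j| ≤ (2∕g)·e^{−θ·dist i j}`.  Proof: apply the complex theorem to `A.map ofReal` — the complex floor follows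
from the real one on real and imaginary parts, and `det`, `⁻¹` commute with `ofReal` (`RingHom.map_det`, `Matrix.inv_eq_left_inv`).
[cite: AizenmanWarzel2015, §10.3 (Combes–Thomas estimate)] [cite: CombesThomas1973, Lemma 1] -/
theorem coercive_combes_thomas_real (dist : ι → ι → ℕ) (hd0 : ∀ i, dist i i = 0)
    (hds : ∀ i j, dist i j = dist j i) (hdt : ∀ i j k, dist i k ≤ dist i j + dist j k)
    (A : Matrix ι ι ℝ) (hrange : ∀ i j, A i j ≠ 0 → dist i j ≤ 1) (h : ℝ)
    (hrow : ∀ i, ∑ j ∈ univ.filter (fun j => dist i j ≠ 0), |A i j| ≤ h)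
    (hcol : ∀ j, ∑ i ∈ univ.filter (fun i => dist i j ≠ 0), |A i j| ≤ h)
    (g θ : ℝ) (hg : 0 < g) (hθ : 0 ≤ θ)
    (hfloor : ∀ v : ι → ℝ, g ^ 2 * ∑ i, (v i) ^ 2 ≤ ∑ i, ((A *ᵥ v) i) ^ 2)
    (hη : h * (Real.exp θ - 1) ≤ g / 2) :
    IsUnit A.det ∧ ∀ i j, |A⁻¹ i j| ≤ 2 / g * Real.exp (-(θ * dist i j)) := by
  -- pass to the complex matrix `Aℂ := A.map ofReal`
  set Ac : Matrix ι ι ℂ := A.map ((↑) : ℝ → ℂ) with hAc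
  have hAc_apply : ∀ i j, Ac i j = (A i j : ℂ) := fun i j => rfl
  have hrangeC : ∀ i j, Ac i j ≠ 0 → dist i j ≤ 1 := fun i j hij =>
    hrange i j (by rw [hAc_apply] at hij; exact_mod_cast hij)
  have hnorm : ∀ i j, ‖Ac i j‖ = |A i j| := fun i j => by
    rw [hAc_apply, Complex.norm_real, Real.norm_eq_abs]
  have hrowC : ∀ i, ∑ j ∈ univ.filter (fun j => dist i j ≠ 0), ‖Ac i j‖ ≤ h := fun i => by
    simp only [hnorm]; exact hrow i
  have hcolC : ∀ j, ∑ i ∈ univ.filter (fun i => dist i j ≠ 0), ‖Ac i j‖ ≤ h := fun j => by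
    simp only [hnorm]; exact hcol j
  -- the complex floor from the real one, componentwise in `re`/`im`
  have hfloorC : ∀ v : ι → ℂ, g ^ 2 * ∑ i, ‖v i‖ ^ 2 ≤ ∑ i, ‖(Ac *ᵥ v) i‖ ^ 2 := by
    intro v
    have hre : ∀ i, ((Ac *ᵥ v) i).re = (A *ᵥ fun j => (v j).re) i := by
      intro i
      simp only [Matrix.mulVec, dotProduct, hAc_apply, Complex.re_sum, Complex.re_ofReal_mul]
    have him : ∀ i, ((Ac *ᵥ v) i).im = (A *ᵥ fun j => (v j).im) i := by
      intro i
      simp only [Matrix.mulVec, dotProduct, hAc_apply, Complex.im_sum, Complex.im_ofReal_mul]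
    have hsq : ∀ z : ℂ, ‖z‖ ^ 2 = z.re ^ 2 + z.im ^ 2 := fun z => by
      rw [Complex.sq_norm, Complex.normSq_apply]; ring
    have h1 := hfloor fun j => (v j).re
    have h2 := hfloor fun j => (v j).im
    calc g ^ 2 * ∑ i, ‖v i‖ ^ 2 = g ^ 2 * ∑ i, (v i).re ^ 2 + g ^ 2 * ∑ i, (v i).im ^ 2 := by
          simp only [hsq, Finset.sum_add_distrib]; ring
      _ ≤ ∑ i, ((A *ᵥ fun j => (v j).re) i) ^ 2 + ∑ i, ((A *ᵥ fun j => (v j).im) i) ^ 2 := add_le_add h1 h2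
      _ = ∑ i, ‖(Ac *ᵥ v) i‖ ^ 2 := by
          rw [← Finset.sum_add_distrib]
          exact Finset.sum_congr rfl fun i _ => by rw [hsq, hre, him]
  obtain ⟨hdetC, hB⟩ := coercive_combes_thomas dist hd0 hds hdt Ac hrangeC h hrowC hcolC g θ hg hθ hfloorC hη
  -- back to `A`: the determinant and the inverse commute with `ofReal`
  have hdetmap : Ac.det = (A.det : ℂ) := by
    rw [hAc]
    exact (RingHom.map_det Complex.ofRealHom A).symm
  have hdet : IsUnit A.det := by
    rw [isUnit_iff_ne_zero]
    intro h0
    rw [hdetmap, h0, Complex.ofReal_zero] at hdetC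
    exact not_isUnit_zero hdetC
  have hinv : Ac⁻¹ = A⁻¹.map ((↑) : ℝ → ℂ) := by
    refine Matrix.inv_eq_left_inv ?_
    have hmul : A⁻¹.map ((↑) : ℝ → ℂ) * Ac = (A⁻¹ * A).map ((↑) : ℝ → ℂ) := by
      rw [hAc]; exact (Matrix.map_mul (f := Complex.ofRealHom)).symm
    rw [hmul, Matrix.nonsing_inv_mul _ hdet]
    exact Matrix.map_one _ Complex.ofReal_zero Complex.ofReal_one
  refine ⟨hdet, fun i j => ?_⟩
  have hij := hB i j
  rwa [hinv, Matrix.map_apply, Complex.norm_real, Real.norm_eq_abs] at hij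


omit [DecidableEq ι] in
/-- From a QUADRATIC-FORM floor to the coercivity floor of `coercive_combes_thomas_real`: if `m·Σ (v i)² ≤ Σ v i·(A v) i`
for all `v` (`m > 0`; e.g. a symmetric positive-definite Hessian with smallest eigenvalue `≥ m`), then `m²·Σ (v i)² ≤ Σ ((A v) i)²`
(Cauchy–Schwarz).  This is the real form of the «accretive ⇒ coercive» step of `CoerciveCombesThomas.accretive_combes_thomas`.
[cite: AizenmanWarzel2015, §10.3 (Combes–Thomas estimate)] -/
theorem sq_floor_of_quadratic_floor (A : Matrix ι ι ℝ) {m : ℝ} (hm : 0 < m)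
    (hquad : ∀ v : ι → ℝ, m * ∑ i, (v i) ^ 2 ≤ ∑ i, v i * (A *ᵥ v) i) (v : ι → ℝ) :
    m ^ 2 * ∑ i, (v i) ^ 2 ≤ ∑ i, ((A *ᵥ v) i) ^ 2 := by
  have hS : 0 ≤ ∑ i, (v i) ^ 2 := Finset.sum_nonneg fun i _ => sq_nonneg _
  rcases hS.eq_or_lt with hS0 | hSpos
  · -- `v = 0`
    rw [← hS0, mul_zero]
    exact Finset.sum_nonneg fun i _ => sq_nonneg _
  · have hcs : (∑ i, v i * (A *ᵥ v) i) ^ 2 ≤ (∑ i, (v i) ^ 2) * ∑ i, ((A *ᵥ v) i) ^ 2 :=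
      Finset.sum_mul_sq_le_sq_mul_sq univ v (A *ᵥ v)
    have hq := hquad v
    have hq0 : 0 ≤ m * ∑ i, (v i) ^ 2 := by positivity
    have h2 : (m * ∑ i, (v i) ^ 2) ^ 2 ≤ (∑ i, (v i) ^ 2) * ∑ i, ((A *ᵥ v) i) ^ 2 :=
      (pow_le_pow_left₀ hq0 hq 2).trans hcs
    -- divide by `Σ v² > 0`
    have h3 : m ^ 2 * (∑ i, (v i) ^ 2) * (∑ i, (v i) ^ 2) ≤ (∑ i, ((A *ᵥ v) i) ^ 2) * ∑ i, (v i) ^ 2 := by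
      calc m ^ 2 * (∑ i, (v i) ^ 2) * (∑ i, (v i) ^ 2) = (m * ∑ i, (v i) ^ 2) ^ 2 := by ring
        _ ≤ (∑ i, (v i) ^ 2) * ∑ i, ((A *ᵥ v) i) ^ 2 := h2
        _ = (∑ i, ((A *ᵥ v) i) ^ 2) * ∑ i, (v i) ^ 2 := by ring
    exact le_of_mul_le_mul_right h3 hSpos


/-- ★★ **LOCALISATION OF THE FIRST-ORDER RESPONSE, END TO END** ([Balaban1985Variational] (10), linear-algebra content).  Let the real
matrix `A` (the Hessian at a non-degenerate critical point) have range one for `dist`, absolute row∕column sums `≤ h` off `{dist = 0}`,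
the coercivity floor `g²·Σ (v i)² ≤ Σ ((A v) i)²` (`g > 0`), and let `θ ≥ 0` satisfy `h·(e^θ − 1) ≤ g∕2`.  If the response row
`w + A *ᵥ m′ = 0` holds with a source `w` supported in the block `I`, `|w| ≤ δ` there, then at every index `k` that is `R`-far from `I`
(`R ≤ dist k l` for `l ∈ I`): `|m′ k| ≤ (2∕g)·δ·|I|·e^{−θR}`. [cite: Balaban1985Variational, Thm 1 (10) p. 279]
[cite: AizenmanWarzel2015, §10.3] -/
theorem abs_response_le_of_floor_far (dist : ι → ι → ℕ) (hd0 : ∀ i, dist i i = 0)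
    (hds : ∀ i j, dist i j = dist j i) (hdt : ∀ i j k, dist i k ≤ dist i j + dist j k)
    (A : Matrix ι ι ℝ) (hrange : ∀ i j, A i j ≠ 0 → dist i j ≤ 1) (h : ℝ)
    (hrow : ∀ i, ∑ j ∈ univ.filter (fun j => dist i j ≠ 0), |A i j| ≤ h)
    (hcol : ∀ j, ∑ i ∈ univ.filter (fun i => dist i j ≠ 0), |A i j| ≤ h)
    (g θ : ℝ) (hg : 0 < g) (hθ : 0 ≤ θ)
    (hfloor : ∀ v : ι → ℝ, g ^ 2 * ∑ i, (v i) ^ 2 ≤ ∑ i, ((A *ᵥ v) i) ^ 2)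
    (hη : h * (Real.exp θ - 1) ≤ g / 2)
    {w m' : ι → ℝ} (hroww : w + A *ᵥ m' = 0)
    {I : Finset ι} {δ : ℝ} (hδ : 0 ≤ δ) (hw0 : ∀ l, l ∉ I → w l = 0) (hwb : ∀ l ∈ I, |w l| ≤ δ)
    {k : ι} {R : ℕ} (hR : ∀ l ∈ I, R ≤ dist k l) :
    |m' k| ≤ 2 / g * δ * I.card * Real.exp (-(θ * R)) := by
  obtain ⟨hdet, hinv⟩ := coercive_combes_thomas_real dist hd0 hds hdt A hrange h hrow hcol g θ hg hθ hfloor hη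
  exact abs_response_le_of_row_far dist hdet (by positivity) hθ hinv hroww hδ hw0 hwb hR

/-! ## §2 The rectangle with exponentially localised variations -/

open MeasureTheory intervalIntegral in
/-- ★★ **`Δ² log det` OVER A RECTANGLE WITH EXPONENTIALLY LOCALISED VARIATIONS** — the edition of
`LogDetMixedDifference.abs_fourPt_log_det_le` for a Hessian family whose variations come from a RESPONDING background:
a two-parameter family `M(s,t)` of invertible real matrices, entrywise C¹ in `s` at `t = 0, 1`; the `s`-variation at `t = 1`
localised along the column profile `d` (`|M′(s,1) x a| ≤ δ·e^{−θ·d a}`), the `t`-variation `M(s,1) − M(s,0)` along the row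
profile `d′` (`≤ ε·e^{−θ·d′ b}`), the profiles `R` apart through `dist` (`R ≤ d a + dist a b + d′ b`); Combes–Thomas decay of
`M(s,1)⁻¹` (`≤ α·e^{−θ·dist}`), global entries `|M(s,0)⁻¹| ≤ β₀`, and MIXED RESPONSE `|M′(s,1) − M′(s,0)| ≤ η`.  Then
`|log det M(0,0) − log det M(1,0) − (log det M(0,1) − log det M(1,1))| ≤ |n|⁴·α·ε·β₀·δ·e^{−θR} + |n|²·β₀·η`.
[cite: Balaban1985Variational, Thm 1 (10) p. 279] [cite: GlimmJaffe1987, §18.2] -/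
theorem abs_fourPt_log_det_le_of_expLocalised (dist : n → n → ℕ) {M M' : ℝ → ℝ → Matrix n n ℝ}
    (hM : ∀ t s i j, HasDerivAt (fun s => M s t i j) (M' s t i j) s) (hM'c : ∀ t i j, Continuous fun s => M' s t i j)
    (hne : ∀ s t, (M s t).det ≠ 0)
    {α ε δ β₀ η θ : ℝ} (hα : 0 ≤ α) (hε : 0 ≤ ε) (hδ : 0 ≤ δ) (hβ₀ : 0 ≤ β₀) (hθ : 0 ≤ θ)
    {d d' : n → ℕ} (hD : ∀ s x a, |M' s 1 x a| ≤ δ * Real.exp (-(θ * d a)))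
    (hE : ∀ s b c, |(M s 1 - M s 0) b c| ≤ ε * Real.exp (-(θ * d' b)))
    {R : ℕ} (hsep : ∀ a b, R ≤ d a + dist a b + d' b)
    (hA : ∀ s a b, |(M s 1)⁻¹ a b| ≤ α * Real.exp (-(θ * dist a b)))
    (hB0 : ∀ s a b, |(M s 0)⁻¹ a b| ≤ β₀) (hR : ∀ s a b, |(M' s 1 - M' s 0) a b| ≤ η) :
    |Real.log (M 0 0).det - Real.log (M 1 0).det - (Real.log (M 0 1).det - Real.log (M 1 1).det)|
      ≤ (Fintype.card n : ℝ) ^ 4 * α * ε * β₀ * δ * Real.exp (-(θ * R)) + (Fintype.card n : ℝ) ^ 2 * β₀ * η := by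
  have h1 := log_det_sub_eq_integral_trace (M := fun s => M s 1) (M' := fun s => M' s 1) (hM 1) (hM'c 1) (fun s => hne s 1)
  have h0 := log_det_sub_eq_integral_trace (M := fun s => M s 0) (M' := fun s => M' s 0) (hM 0) (hM'c 0) (fun s => hne s 0)
  have hcont : ∀ t, Continuous fun s => ((M s t)⁻¹ * M' s t).trace := by
    intro t
    have hMc : Continuous fun s => M s t :=
      continuous_matrix fun i j => continuous_iff_continuousAt.2 fun s => (hM t s i j).continuousAt
    have hinv : Continuous fun s => (M s t)⁻¹ := by
      refine continuous_iff_continuousAt.2 fun s => ?_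
      have h : ContinuousAt Ring.inverse (M s t).det := by
        rw [Ring.inverse_eq_inv']
        exact continuousAt_inv₀ (hne s t)
      exact ContinuousAt.comp (f := fun s => M s t) (g := fun A : Matrix n n ℝ => A⁻¹)
        (continuousAt_matrix_inv (M s t) h) hMc.continuousAt
    exact (hinv.mul (continuous_matrix (hM'c t))).matrix_trace
  have hrw : Real.log (M 0 0).det - Real.log (M 1 0).det - (Real.log (M 0 1).det - Real.log (M 1 1).det) =
      ∫ s in (0 : ℝ)..1, (((M s 1)⁻¹ * M' s 1).trace - ((M s 0)⁻¹ * M' s 0).trace) := by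
    rw [intervalIntegral.integral_sub ((hcont 1).intervalIntegrable _ _) ((hcont 0).intervalIntegrable _ _)]
    beta_reduce at h1 h0
    linarith
  rw [hrw]
  have hpt : ∀ s, |((M s 1)⁻¹ * M' s 1).trace - ((M s 0)⁻¹ * M' s 0).trace| ≤
      (Fintype.card n : ℝ) ^ 4 * α * ε * β₀ * δ * Real.exp (-(θ * R)) + (Fintype.card n : ℝ) ^ 2 * β₀ * η := by
    intro s
    rw [trace_inv_mul_sub_trace_inv_mul (hne s 0) (hne s 1)]
    refine (abs_add_le _ _).trans (add_le_add ?_ ?_)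
    · rw [abs_neg]
      exact abs_trace_mul4_le_of_expLocalised dist hα hε hβ₀ hδ hθ (hA s) (hB0 s) (hD s) (hE s) hsep
    · exact abs_trace_mul_le_of_entry_le hβ₀ (hB0 s) (hR s)
  have hbd := intervalIntegral.norm_integral_le_of_norm_le_const (a := (0 : ℝ)) (b := 1)
    (f := fun s => ((M s 1)⁻¹ * M' s 1).trace - ((M s 0)⁻¹ * M' s 0).trace)
    (C := (Fintype.card n : ℝ) ^ 4 * α * ε * β₀ * δ * Real.exp (-(θ * R)) + (Fintype.card n : ℝ) ^ 2 * β₀ * η)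
    (fun s _ => by rw [Real.norm_eq_abs]; exact hpt s)
  rw [Real.norm_eq_abs, sub_zero, abs_one, mul_one] at hbd
  exact hbd


/-! ## §3 The responding branch exists: the response row from the implicit function theorem -/

omit [DecidableEq n] in
/-- ★ **THE RESPONDING BRANCH AND ITS RESPONSE ROW** (implicit function theorem, bivariate, with the derivative formula
`ψ′ = −(∂₂G)⁻¹ ∘ ∂₁G` — Mathlib `hasStrictFDerivAt_implicitFunctionOfBivariate`).  Let `G : ℝ → (n → ℝ) → (n → ℝ)` (a gradient
field depending on a bond parameter `s`) have partial derivatives `G₁`, `G₂` near `u = (s₀, m₀)`, continuous at `u`, with `G₂ u`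
invertible and acting as the matrix `A` (the Hessian), and `G s₀ m₀ = 0`.  Then there is a branch `m` of zeros through `u`
(`m s₀ = m₀`, `G s (m s) = 0` for `s` near `s₀`), differentiable at `s₀`, whose derivative `m′` satisfies the response row
`G₁ u 1 + A *ᵥ m′ = 0`. [cite: Rudin1976, Thm 9.28 (implicit function theorem, derivative formula)] -/
theorem exists_branch_response_row {G : ℝ → (n → ℝ) → (n → ℝ)} {u : ℝ × (n → ℝ)}
    {G₁ : ℝ → (n → ℝ) → ℝ →L[ℝ] (n → ℝ)} {G₂ : ℝ → (n → ℝ) → (n → ℝ) →L[ℝ] (n → ℝ)}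
    (dG₁ : ∀ᶠ v in 𝓝 u, HasFDerivAt (G · v.2) (G₁ v.1 v.2) v.1)
    (dG₂ : ∀ᶠ v in 𝓝 u, HasFDerivAt (G v.1 ·) (G₂ v.1 v.2) v.2)
    (cG₁ : ContinuousAt ↿G₁ u) (cG₂ : ContinuousAt ↿G₂ u) (iG₂ : (G₂ u.1 u.2).IsInvertible)
    (hcrit : G u.1 u.2 = 0) {A : Matrix n n ℝ} (hAG : ∀ v, G₂ u.1 u.2 v = A *ᵥ v) :
    ∃ m : ℝ → (n → ℝ), m u.1 = u.2 ∧ (∀ᶠ s in 𝓝 u.1, G s (m s) = 0) ∧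
      ∃ m' : n → ℝ, HasDerivAt m m' u.1 ∧ G₁ u.1 u.2 1 + A *ᵥ m' = 0 := by
  set ψ := implicitFunctionOfBivariate dG₁ dG₂ cG₁ cG₂ iG₂ with hψ
  have hψd : HasStrictFDerivAt ψ (-(G₂ u.1 u.2).inverse ∘L G₁ u.1 u.2) u.1 :=
    hasStrictFDerivAt_implicitFunctionOfBivariate dG₁ dG₂ cG₁ cG₂ iG₂
  have hev : ∀ᶠ x in 𝓝 u.1, G x (ψ x) = G u.1 u.2 :=
    eventually_apply_implicitFunctionOfBivariate dG₁ dG₂ cG₁ cG₂ iG₂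
  have hiff := (eventually_apply_eq_iff_implicitFunctionOfBivariate dG₁ dG₂ cG₁ cG₂ iG₂).self_of_nhds
  have hψu : ψ u.1 = u.2 := by
    have : G u.1 u.2 = G u.1 u.2 ↔ ψ u.1 = u.2 := hiff
    exact this.mp rfl
  refine ⟨ψ, hψu, hev.mono fun x hx => by rw [hx, hcrit], ?_⟩
  set m' : n → ℝ := (-(G₂ u.1 u.2).inverse ∘L G₁ u.1 u.2) (1 : ℝ) with hm'
  have hderiv : HasDerivAt ψ m' u.1 := by
    have h := hψd.hasFDerivAt.hasDerivAt
    simpa [hm'] using h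
  refine ⟨m', hderiv, ?_⟩
  rw [← hAG m', hm']
  simp only [ContinuousLinearMap.coe_comp, Function.comp_apply, _root_.neg_apply, map_neg,
    ContinuousLinearMap.IsInvertible.self_apply_inverse iG₂, add_neg_cancel]

/-- ★★ **THE LOCALISED RESPONSE OF A NON-DEGENERATE CRITICAL POINT, END TO END** ([Balaban1985Variational] Thm 1, (10) p. 279 —
the finite-dimensional mechanism).  With the data of `exists_branch_response_row` (gradient field `G`, Hessian `G₂ u` acting as the
real matrix `A`, `G s₀ m₀ = 0`), if `A` has range one for `dist`, absolute row∕column sums `≤ h` off `{dist = 0}`, the coercivity floor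
`g²·Σ (v i)² ≤ Σ ((A v) i)²` (`g > 0`), `h·(e^θ − 1) ≤ g∕2` (`θ ≥ 0`), and the `s`-partial `G₁ u 1` is supported in the block `I` with
entries `≤ δ`, then the zero set is locally a differentiable branch `m` through `u` whose response `m′` at `s₀` satisfies
`|m′ k| ≤ (2∕g)·δ·|I|·e^{−θR}` at every index `k` that is `R`-far from `I`. [cite: Balaban1985Variational, Thm 1 (10) p. 279]
[cite: AizenmanWarzel2015, §10.3] -/
theorem exists_branch_localisedResponse (dist : n → n → ℕ) (hd0 : ∀ i, dist i i = 0)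
    (hds : ∀ i j, dist i j = dist j i) (hdt : ∀ i j k, dist i k ≤ dist i j + dist j k)
    {G : ℝ → (n → ℝ) → (n → ℝ)} {u : ℝ × (n → ℝ)}
    {G₁ : ℝ → (n → ℝ) → ℝ →L[ℝ] (n → ℝ)} {G₂ : ℝ → (n → ℝ) → (n → ℝ) →L[ℝ] (n → ℝ)}
    (dG₁ : ∀ᶠ v in 𝓝 u, HasFDerivAt (G · v.2) (G₁ v.1 v.2) v.1)
    (dG₂ : ∀ᶠ v in 𝓝 u, HasFDerivAt (G v.1 ·) (G₂ v.1 v.2) v.2)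
    (cG₁ : ContinuousAt ↿G₁ u) (cG₂ : ContinuousAt ↿G₂ u) (iG₂ : (G₂ u.1 u.2).IsInvertible)
    (hcrit : G u.1 u.2 = 0) {A : Matrix n n ℝ} (hAG : ∀ v, G₂ u.1 u.2 v = A *ᵥ v)
    (hrange : ∀ i j, A i j ≠ 0 → dist i j ≤ 1) (h : ℝ)
    (hrow : ∀ i, ∑ j ∈ univ.filter (fun j => dist i j ≠ 0), |A i j| ≤ h)
    (hcol : ∀ j, ∑ i ∈ univ.filter (fun i => dist i j ≠ 0), |A i j| ≤ h)
    (g θ : ℝ) (hg : 0 < g) (hθ : 0 ≤ θ)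
    (hfloor : ∀ v : n → ℝ, g ^ 2 * ∑ i, (v i) ^ 2 ≤ ∑ i, ((A *ᵥ v) i) ^ 2)
    (hη : h * (Real.exp θ - 1) ≤ g / 2)
    {I : Finset n} {δ : ℝ} (hδ : 0 ≤ δ) (hw0 : ∀ l, l ∉ I → G₁ u.1 u.2 1 l = 0)
    (hwb : ∀ l ∈ I, |G₁ u.1 u.2 1 l| ≤ δ) :
    ∃ m : ℝ → (n → ℝ), m u.1 = u.2 ∧ (∀ᶠ s in 𝓝 u.1, G s (m s) = 0) ∧
      ∃ m' : n → ℝ, HasDerivAt m m' u.1 ∧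
        ∀ (k : n) (R : ℕ), (∀ l ∈ I, R ≤ dist k l) → |m' k| ≤ 2 / g * δ * I.card * Real.exp (-(θ * R)) := by
  obtain ⟨m, hm0, hmz, m', hmd, hrow'⟩ := exists_branch_response_row dG₁ dG₂ cG₁ cG₂ iG₂ hcrit hAG
  exact ⟨m, hm0, hmz, m', hmd, fun k R hR =>
    abs_response_le_of_floor_far dist hd0 hds hdt A hrange h hrow hcol g θ hg hθ hfloor hη hrow' hδ hw0 hwb hR⟩

end Literature.Analysis.Matrix

end
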